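import Summits.AtomisticToContinuum.Crystallization.Theses.SquareWellLayerCake

/-!
# Route `SquareWellLayerCake`, item stmt-AtomisticToContinuum-15809 `FirstZoneExact`

`FirstZoneExact` (support item of route `SquareWellLayerCake`, sub-problem `Crystallization`):
`AveragedTwelve` implies that for every finite configuration `x : Fin N → ℝ³` and every index set
`G` with pairwise distances `≥ 55/57`, the clipped first-zone energy
`∑_{i ∈ G} ∑_{j ∈ G, i < j, r_ij ≤ 1.1} (V_LJ(max(r_ij, 1)) − V_LJ(1.1))` is at least
`6·|G|·(V_LJ(1) − V_LJ(1.1))`.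

Proof.  Every summand is `≥ c := V_LJ(1) − V_LJ(1.1)` because `V_LJ(1) = −1/12` is the global
minimum of `V_LJ` (`neg_one_div_le_lennardJones`, `lennardJones_one`), so the double sum is
`≥ P · c` with `P` the number of pairs `i < j` of `G` at distance `≤ 1.1`.  `AveragedTwelve` at
`(d, ρ) = (55/57, 11/10)` (note `57/50 · 55/57 = 11/10`) bounds the ordered count, which is `2P`
(split `j ≠ i` into `i < j` / `j < i` and swap the summation order in the second half, using
`dist_comm`), by `12 |G|`; finally `c ≤ 0` turns `P ≤ 6 |G|` into `6 |G| · c ≤ P · c`.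
No facts beyond the tree are used; the result is unconditional.
-/

namespace Summit.AtomisticToContinuum.Crystallization.Theorems

open Literature.MathematicalPhysics.StatisticalMechanics

/-- **Ordered first-zone pairs are twice the unordered ones.**  For a finite configuration
`x : Fin N → ℝ³`, an index set `G` and a radius `ρ`, the ordered neighbour count
`∑_{i ∈ G} #{j ∈ G : j ≠ i, dist(x i, x j) ≤ ρ}` equals twice the count of pairs with `i < j`
(real-valued form, as consumed by `AveragedTwelve`). -/
theorem squareWellLayerCake_sum_card_filter_ne_eq_two_mul {N : ℕ}
    (x : Fin N → EuclideanSpace ℝ (Fin 3)) (G : Finset (Fin N)) (ρ : ℝ) :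
    (∑ i ∈ G, ((G.filter fun j => j ≠ i ∧ dist (x i) (x j) ≤ ρ).card : ℝ)) =
      2 * ∑ i ∈ G, ((G.filter fun j => i < j ∧ dist (x i) (x j) ≤ ρ).card : ℝ) := by
  -- split `j ≠ i` into `i < j` and `j < i`
  have hsplit : ∀ i ∈ G, ((G.filter fun j => j ≠ i ∧ dist (x i) (x j) ≤ ρ).card : ℝ) =
      ((G.filter fun j => i < j ∧ dist (x i) (x j) ≤ ρ).card : ℝ) +
        ((G.filter fun j => j < i ∧ dist (x i) (x j) ≤ ρ).card : ℝ) := by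
    intro i _
    have hunion : (G.filter fun j => j ≠ i ∧ dist (x i) (x j) ≤ ρ) =
        (G.filter fun j => i < j ∧ dist (x i) (x j) ≤ ρ) ∪
          (G.filter fun j => j < i ∧ dist (x i) (x j) ≤ ρ) := by
      ext j
      simp only [Finset.mem_filter, Finset.mem_union]
      constructor
      · rintro ⟨hj, hne, hd⟩
        rcases lt_or_gt_of_ne hne with h | h
        · exact Or.inr ⟨hj, h, hd⟩
        · exact Or.inl ⟨hj, h, hd⟩
      · rintro (⟨hj, h, hd⟩ | ⟨hj, h, hd⟩)
        · exact ⟨hj, h.ne', hd⟩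
        · exact ⟨hj, h.ne, hd⟩
    have hdisj : Disjoint (G.filter fun j => i < j ∧ dist (x i) (x j) ≤ ρ)
        (G.filter fun j => j < i ∧ dist (x i) (x j) ≤ ρ) := by
      rw [Finset.disjoint_filter]
      intro j _ h1 h2
      exact lt_asymm h1.1 h2.1
    rw [hunion, Finset.card_union_of_disjoint hdisj, Nat.cast_add]
  -- the `j < i` half equals the `i < j` half after swapping the order of summation
  have hsymm : (∑ i ∈ G, ((G.filter fun j => j < i ∧ dist (x i) (x j) ≤ ρ).card : ℝ)) =
      ∑ i ∈ G, ((G.filter fun j => i < j ∧ dist (x i) (x j) ≤ ρ).card : ℝ) := by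
    simp only [Finset.card_filter, Nat.cast_sum, Nat.cast_ite, Nat.cast_one, Nat.cast_zero]
    rw [Finset.sum_comm]
    refine Finset.sum_congr rfl fun i _ => Finset.sum_congr rfl fun j _ => ?_
    rw [dist_comm]
  rw [Finset.sum_congr rfl hsplit, Finset.sum_add_distrib, hsymm]
  ring

/-- **Item `stmt-AtomisticToContinuum-15809` (`FirstZoneExact`, route `SquareWellLayerCake`).**
`AveragedTwelve` implies: for every `N`, every configuration `x : Fin N → ℝ³` and every index set
`G` on which pairwise distances are `≥ 55/57`,
`6·|G|·(V_LJ(1) − V_LJ(11/10)) ≤ ∑_{i ∈ G} ∑_{j ∈ G, i < j, dist ≤ 11/10} (V_LJ(max(dist, 1)) − V_LJ(11/10))`.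
Termwise bound by the global minimum `V_LJ(1) = −1/12` plus the pair count `≤ 6|G|` from
`AveragedTwelve` at `(d, ρ) = (55/57, 11/10)`. -/
theorem firstZoneExact_proof :
    Summit.AtomisticToContinuum.Crystallization.Theses.SquareWellLayerCake.FirstZoneExact := by
  unfold Summit.AtomisticToContinuum.Crystallization.Theses.SquareWellLayerCake.FirstZoneExact
  intro hK1 N x G hsep
  set c : ℝ := lennardJones 1 - lennardJones (11 / 10) with hc
  have hc0 : c ≤ 0 := by
    have h := neg_one_div_le_lennardJones (11 / 10)
    rw [hc, lennardJones_one]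
    linarith
  -- (1) termwise lower bound: each clipped summand is `≥ c`
  have hterm : ∀ i ∈ G, ((G.filter fun j => i < j ∧ dist (x i) (x j) ≤ 11 / 10).card : ℝ) * c ≤
      ∑ j ∈ G.filter (fun j => i < j ∧ dist (x i) (x j) ≤ 11 / 10),
        (lennardJones (max (dist (x i) (x j)) 1) - lennardJones (11 / 10)) := by
    intro i _
    rw [← nsmul_eq_mul, ← Finset.sum_const]
    refine Finset.sum_le_sum fun j _ => ?_
    have h := neg_one_div_le_lennardJones (max (dist (x i) (x j)) 1)
    rw [hc, lennardJones_one]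
    linarith
  -- (2) pair count: at most `6 |G|` pairs `i < j` at distance `≤ 11/10`, by `AveragedTwelve`
  have hcount : (∑ i ∈ G, ((G.filter fun j => i < j ∧ dist (x i) (x j) ≤ 11 / 10).card : ℝ)) ≤
      6 * G.card := by
    have hA := hK1 N x G (55 / 57) (11 / 10) (by norm_num) (by norm_num) hsep
    rw [squareWellLayerCake_sum_card_filter_ne_eq_two_mul x G (11 / 10)] at hA
    linarith
  -- (3) combine (`c ≤ 0` reverses the count inequality)
  calc 6 * (G.card : ℝ) * c
      ≤ (∑ i ∈ G, ((G.filter fun j => i < j ∧ dist (x i) (x j) ≤ 11 / 10).card : ℝ)) * c :=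
        mul_le_mul_of_nonpos_right hcount hc0
    _ = ∑ i ∈ G, ((G.filter fun j => i < j ∧ dist (x i) (x j) ≤ 11 / 10).card : ℝ) * c := by
        rw [Finset.sum_mul]
    _ ≤ ∑ i ∈ G, ∑ j ∈ G.filter (fun j => i < j ∧ dist (x i) (x j) ≤ 11 / 10),
          (lennardJones (max (dist (x i) (x j)) 1) - lennardJones (11 / 10)) :=
        Finset.sum_le_sum hterm

end Summit.AtomisticToContinuum.Crystallization.Theorems
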